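import Mathlib
import Literature.Combinatorics.Additive.TripleProductProperty
import Literature.Combinatorics.AssociationSchemes.Basic

/-!
# MatrixMultiplication / CommutativeSchemes — `STPPTransfer`, part 1: symmetric powers of the
scheme of an abelian group (Cohn–Umans 2013, Thm. 17)

Route `CommutativeSchemes`, support item `STPPTransfer` (stmt-MatrixMultiplication-9469):
the abelian STPP packing thesis implies `CommutativeRealization` (CU13 Conjecture 21, ε-form).
This file is the combinatorial heart of Cohn–Umans 2013 §5 specialised to abelian groups.

For a finite abelian group `G` and a finite index set `κ`, the **symmetric power**
`Sym^κ 𝒞_G` of the group scheme `𝒞_G` is the association scheme on the point set `κ → G` whose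
class map sends `(x, y)` to the MULTISET of coordinate differences `{y k - x k : k ∈ κ}` — the
orbit under `S_κ` of the class `(y k - x k)_k` of `(x, y)` in the direct power `𝒞_G^κ`
(CU13 §4.2, "the symmetric power `Sym^k 𝒞` is obtained from the direct power `𝒞^k` by fusing
under the action of the symmetric group"). Writing the class map as
`cls x y = univ.val.map (y - x) : Multiset G`, we prove:

* `univ.val.map f = univ.val.map g` iff `g` is a reparametrisation `f ∘ σ` of `f` by a
  permutation `σ` of `κ` (`exists_perm_comp_eq_of_map_univ_eq`, `map_univ_comp_equiv`);
* the class map is an association scheme — one diagonal class, transpose = negation, and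
  coherent: the affine bijections `z ↦ z ∘ σ + w` of `κ → G` preserve classes and act
  transitively on the pairs of a given class (`card_filter_eq_of_map_univ_sub_eq`) — which is
  COMMUTATIVE: `z ↦ x + y - z` swaps the two counts (`card_filter_map_univ_sub_comm`);
* CU13 Thm. 17 for group schemes (`map_univ_sub_triangle_iff`): if `(A k, B k, C k)_{k ∈ κ}` is
  an STPP family in `G`, then for `a, a' ∈ ∏ A k`, `b, b' ∈ ∏ B k`, `c, c' ∈ ∏ C k` the classes
  `{a k - b' k}_k`, `{b k - c' k}_k`, `{c k - a' k}_k` form a triangle iff `a = a'`, `b = b'`,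
  `c = c'` — a triangle unscrambles into three permutations of `κ`, which the STPP forces to
  coincide — so the boxes realise `⟨∏|A k|, ∏|B k|, ∏|C k|⟩` (CU13 Def. 12);
* the packaged statement `exists_symPower_scheme`: a uniform STPP family (`|A k| = |B k| =
  |C k| = L`) indexed by `κ` yields a commutative `AssociationScheme` on `κ → G` with classes
  labelled by `Fin #Sym^{|κ|} G` realising `⟨L^|κ|, L^|κ|, L^|κ|⟩`.

Part 2 (`CommutativeSchemesSTPPTransfer.lean`) does the counting (`#Sym^{K} G = C(|G|+K-1, K)`,
CU13 Cor. 18 / Thm. 19) and closes the item.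

References: H. Cohn, C. Umans, *Fast matrix multiplication using coherent configurations*,
SODA 2013, arXiv:1207.6528, §4.2, Def. 11/12, §5 Thm. 17 (p. 12 of the arXiv version).
-/

-- the tree's namespace `Summit.MatrixMultiplication.MatrixMultiplication.…` repeats a component by design
set_option linter.dupNamespace false

namespace Summit.MatrixMultiplication.MatrixMultiplication.Theorems

open Finset Function Literature.Combinatorics.AssociationSchemes

section Words

variable {G : Type*} {κ : Type*} [Fintype κ]

/-- Reparametrising a word `f : κ → G` by a permutation of `κ` does not change its multiset of
letters. [folklore] -/
theorem map_univ_comp_equiv (f : κ → G) (σ : Equiv.Perm κ) :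
    (univ : Finset κ).val.map (f ∘ σ) = univ.val.map f := by
  rw [← Multiset.map_map, Multiset.map_univ_val_equiv]

/-- Two words `f g : κ → G` with the same multiset of letters differ by a permutation of `κ`
(glue fibrewise bijections `f⁻¹(c) ≃ g⁻¹(c)`, which exist because the multiplicities of every
letter `c` agree). [folklore] -/
theorem exists_perm_comp_eq_of_map_univ_eq [DecidableEq G] {f g : κ → G}
    (h : (univ : Finset κ).val.map f = univ.val.map g) : ∃ σ : Equiv.Perm κ, f ∘ σ = g := by
  classical
  have hc : ∀ c : G, Fintype.card {k // g k = c} = Fintype.card {k // f k = c} := by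
    intro c
    have h1 := congrArg (Multiset.count c) h
    rw [Multiset.count_map, Multiset.count_map] at h1
    rw [Fintype.card_subtype, Fintype.card_subtype]
    have e1 : (univ.filter fun k => g k = c).card =
        Multiset.card (univ.val.filter fun k => c = g k) := by
      rw [Finset.card_def, Finset.filter_val]
      congr 1
      exact Multiset.filter_congr fun k _ => eq_comm
    have e2 : (univ.filter fun k => f k = c).card =
        Multiset.card (univ.val.filter fun k => c = f k) := by
      rw [Finset.card_def, Finset.filter_val]
      congr 1
      exact Multiset.filter_congr fun k _ => eq_comm
    rw [e1, e2, h1]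
  exact ⟨Equiv.ofFiberEquiv fun c => Fintype.equivOfCardEq (hc c),
    funext fun k => Equiv.ofFiberEquiv_map _ k⟩

end Words

section SymPower

variable {G : Type*} [AddCommGroup G] {κ : Type*} [Fintype κ]

/-- One diagonal class: the multiset of coordinate differences of `(x, y)` is that of a diagonal
pair `(z, z)` (all zero) iff `x = y`. [cite: CohnUmans2013, §4.2] -/
theorem map_univ_sub_eq_map_univ_sub_self_iff (x y z : κ → G) :
    (univ : Finset κ).val.map (y - x) = univ.val.map (z - z) ↔ x = y := by
  constructor
  · intro h
    funext k
    have hk : (y - x) k ∈ (univ : Finset κ).val.map (y - x) :=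
      Multiset.mem_map_of_mem _ (mem_univ k)
    rw [h, sub_self, Multiset.mem_map] at hk
    obtain ⟨k', -, hk'⟩ := hk
    rw [Pi.zero_apply, Pi.sub_apply] at hk'
    exact (sub_eq_zero.1 hk'.symm).symm
  · rintro rfl
    rw [sub_self, sub_self]

/-- Transposition acts on the classes by negation: the difference multiset of `(y, x)` is the
negative of that of `(x, y)`. [cite: CohnUmans2013, §4.2] -/
theorem map_univ_sub_swap (x y : κ → G) :
    (univ : Finset κ).val.map (x - y) = ((univ : Finset κ).val.map (y - x)).map Neg.neg := by
  rw [Multiset.map_map]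
  congr 1
  funext k
  simp only [comp_apply, Pi.sub_apply, neg_sub]

/-- Coherence of the symmetric power: the number of `z` with prescribed difference multisets
to `x` and from `y` depends only on the difference multiset of `(x, y)` — if `(x, y)` and
`(x', y')` have the same class, an affine bijection `z ↦ z ∘ σ - x ∘ σ + x'` of `κ → G` carries
one solution set onto the other. [cite: CohnUmans2013, §4.2] -/
theorem card_filter_eq_of_map_univ_sub_eq [Fintype G] [DecidableEq G] [DecidableEq κ]
    (a b : Multiset G)
    {x y x' y' : κ → G} (h : (univ : Finset κ).val.map (y - x) = univ.val.map (y' - x')) :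
    (univ.filter fun z : κ → G =>
        (univ : Finset κ).val.map (z - x) = a ∧ (univ : Finset κ).val.map (y - z) = b).card =
      (univ.filter fun z : κ → G =>
        (univ : Finset κ).val.map (z - x') = a ∧ (univ : Finset κ).val.map (y' - z) = b).card := by
  classical
  obtain ⟨σ, hσ⟩ := exists_perm_comp_eq_of_map_univ_eq h
  refine Finset.card_equiv
    (Equiv.mk (fun (z : κ → G) (k : κ) => z (σ k) - x (σ k) + x' k)
      (fun (z : κ → G) (k : κ) => z (σ.symm k) - x' (σ.symm k) + x (σ (σ.symm k))) ?_ ?_) ?_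
  · intro z
    funext k
    simp only [Equiv.apply_symm_apply, sub_add_cancel, add_sub_cancel_right]
  · intro z
    funext k
    simp only [Equiv.symm_apply_apply, sub_add_cancel, add_sub_cancel_right]
  · intro z
    simp only [mem_filter, mem_univ, true_and, Equiv.coe_fn_mk]
    have e1 : ((fun k => z (σ k) - x (σ k) + x' k) - x') = (z - x) ∘ σ := by
      funext k
      simp only [Pi.sub_apply, comp_apply, add_sub_cancel_right]
    have e2 : (y' - fun k => z (σ k) - x (σ k) + x' k) = (y - z) ∘ σ := by
      funext k
      have hk := congr_fun hσ k
      simp only [comp_apply, Pi.sub_apply] at hk ⊢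
      rw [sub_eq_iff_eq_add.1 hk.symm]
      abel
    rw [e1, e2, map_univ_comp_equiv, map_univ_comp_equiv]

/-- Commutativity of the symmetric power of an abelian group scheme: `z ↦ x + y - z` exchanges
the solutions of `(cls x z, cls z y) = (a, b)` with those of `(cls x z, cls z y) = (b, a)`.
[cite: CohnUmans2013, §4.2] -/
theorem card_filter_map_univ_sub_comm [Fintype G] [DecidableEq G] [DecidableEq κ] (a b : Multiset G)
    (x y : κ → G) :
    (univ.filter fun z : κ → G =>
        (univ : Finset κ).val.map (z - x) = a ∧ (univ : Finset κ).val.map (y - z) = b).card =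
      (univ.filter fun z : κ → G =>
        (univ : Finset κ).val.map (z - x) = b ∧ (univ : Finset κ).val.map (y - z) = a).card := by
  classical
  refine Finset.card_equiv (Equiv.mk (fun z : κ → G => x + y - z) (fun z => x + y - z) ?_ ?_) ?_
  · intro z; simp only [sub_sub_cancel]
  · intro z; simp only [sub_sub_cancel]
  · intro z
    simp only [mem_filter, mem_univ, true_and, Equiv.coe_fn_mk]
    have e1 : x + y - z - x = y - z := by abel
    have e2 : y - (x + y - z) = z - x := by abel
    rw [e1, e2, and_comm]

/-- **Cohn–Umans 2013, Thm. 17, for the scheme of an abelian group.** If `(A k, B k, C k)_{k ∈ κ}`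
is an STPP family in `G`, then for `a, a' ∈ ∏ₖ A k`, `b, b' ∈ ∏ₖ B k`, `c, c' ∈ ∏ₖ C k` the three
classes of `Sym^κ 𝒞_G` given by the difference multisets `{a k - b' k}ₖ`, `{b k - c' k}ₖ`,
`{c k - a' k}ₖ` form a triangle iff `a = a'`, `b = b'`, `c = c'`: a triangle `x, y, z` yields
permutations `π, ρ, σ` of `κ` with `y - x = (a - b') ∘ π`, `z - y = (b - c') ∘ ρ`,
`x - z = (c - a') ∘ σ`; summing, coordinate `k` gives the STPP relation
`(a (π k) - a' (σ k)) + (b (ρ k) - b' (π k)) + (c (σ k) - c' (ρ k)) = 0`, whence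
`π k = ρ k = σ k` and the letters agree; conversely `(0, a - b, a - c)` is a triangle.
[cite: CohnUmans2013, Thm. 17] -/
theorem map_univ_sub_triangle_iff [DecidableEq G] {A B C : κ → Finset G}
    (hS : Literature.Combinatorics.Additive.AddSimultaneousTPP A B C) {a a' b b' c c' : κ → G}
    (ha : ∀ k, a k ∈ A k) (ha' : ∀ k, a' k ∈ A k) (hb : ∀ k, b k ∈ B k) (hb' : ∀ k, b' k ∈ B k)
    (hc : ∀ k, c k ∈ C k) (hc' : ∀ k, c' k ∈ C k) :
    (∃ x y z : κ → G, (univ : Finset κ).val.map (y - x) = univ.val.map (a - b') ∧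
        (univ : Finset κ).val.map (z - y) = univ.val.map (b - c') ∧
          (univ : Finset κ).val.map (x - z) = univ.val.map (c - a')) ↔
      (a = a' ∧ b = b' ∧ c = c') := by
  rw [Literature.Combinatorics.Additive.addSimultaneousTPP_iff_forall] at hS
  constructor
  · rintro ⟨x, y, z, h1, h2, h3⟩
    obtain ⟨π, hπ⟩ := exists_perm_comp_eq_of_map_univ_eq h1.symm
    obtain ⟨ρ, hρ⟩ := exists_perm_comp_eq_of_map_univ_eq h2.symm
    obtain ⟨σ, hσ⟩ := exists_perm_comp_eq_of_map_univ_eq h3.symm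
    have key : ∀ k, (π k = ρ k ∧ ρ k = σ k) ∧
        a' (σ k) = a (π k) ∧ b' (π k) = b (ρ k) ∧ c' (ρ k) = c (σ k) := by
      intro k
      have hk1 := congr_fun hπ k
      have hk2 := congr_fun hρ k
      have hk3 := congr_fun hσ k
      simp only [comp_apply, Pi.sub_apply] at hk1 hk2 hk3
      have h0 : (a (π k) - a' (σ k)) + (b (ρ k) - b' (π k)) + (c (σ k) - c' (ρ k)) = 0 := by
        have h4 : (a (π k) - b' (π k)) + (b (ρ k) - c' (ρ k)) + (c (σ k) - a' (σ k)) = 0 := by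
          rw [hk1, hk2, hk3]; abel
        rw [← h4]; abel
      obtain ⟨hij, hjk, hs, ht, hu⟩ := hS (π k) (ρ k) (σ k) (a' (σ k)) (ha' _) (a (π k)) (ha _)
        (b' (π k)) (hb' _) (b (ρ k)) (hb _) (c' (ρ k)) (hc' _) (c (σ k)) (hc _) h0
      exact ⟨⟨hij, hjk⟩, hs, ht, hu⟩
    have hπσ : ∀ k, π k = σ k := fun k => (key k).1.1.trans (key k).1.2
    have hρσ : ∀ k, ρ k = σ k := fun k => (key k).1.2
    refine ⟨funext fun m => ?_, funext fun m => ?_, funext fun m => ?_⟩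
    · obtain ⟨k, rfl⟩ := σ.surjective m
      have h5 := (key k).2.1
      rw [hπσ k] at h5
      exact h5.symm
    · obtain ⟨k, rfl⟩ := σ.surjective m
      have h5 := (key k).2.2.1
      rw [hπσ k, hρσ k] at h5
      exact h5.symm
    · obtain ⟨k, rfl⟩ := σ.surjective m
      have h5 := (key k).2.2.2
      rw [hρσ k] at h5
      exact h5.symm
  · rintro ⟨rfl, rfl, rfl⟩
    refine ⟨0, a - b, a - c, by rw [sub_zero], ?_, ?_⟩
    · congr 1; abel
    · congr 1; abel

/-- In a realisation of a square `⟨n, n, n⟩` the injectivity of `α, β, γ` (part of CU13 Def. 12)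
already follows from the triangle condition: two arguments with the same image complete the
same diagonal triangle. [cite: CohnUmans2013, Def. 12] -/
theorem injective_of_triangle_iff {X ι : Type*} {n : ℕ} (cls : X → X → ι)
    (α β γ : Fin n × Fin n → ι)
    (H : ∀ a a' b b' c c' : Fin n, ((∃ x y z : X, cls x y = α (a, b') ∧ cls y z = β (b, c') ∧
      cls z x = γ (c, a')) ↔ (a = a' ∧ b = b' ∧ c = c'))) :
    Injective α ∧ Injective β ∧ Injective γ := by
  refine ⟨?_, ?_, ?_⟩
  · rintro ⟨a, b'⟩ ⟨a₁, b₁⟩ h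
    obtain ⟨x, y, z, h1, h2, h3⟩ := (H a₁ a₁ b₁ b₁ a a).2 ⟨rfl, rfl, rfl⟩
    obtain ⟨rfl, rfl, -⟩ := (H a a₁ b₁ b' a a).1 ⟨x, y, z, h1.trans h.symm, h2, h3⟩
    rfl
  · rintro ⟨b, c'⟩ ⟨b₁, c₁⟩ h
    obtain ⟨x, y, z, h1, h2, h3⟩ := (H b b b₁ b₁ c₁ c₁).2 ⟨rfl, rfl, rfl⟩
    obtain ⟨-, rfl, rfl⟩ := (H b b b b₁ c₁ c').1 ⟨x, y, z, h1, h2.trans h.symm, h3⟩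
    rfl
  · rintro ⟨c, a'⟩ ⟨c₁, a₁⟩ h
    obtain ⟨x, y, z, h1, h2, h3⟩ := (H a₁ a₁ c₁ c₁ c₁ c₁).2 ⟨rfl, rfl, rfl⟩
    obtain ⟨rfl, -, rfl⟩ := (H a₁ a' c₁ c₁ c c₁).1 ⟨x, y, z, h1, h2, h3.trans h.symm⟩
    rfl

/-- **The symmetric power of an abelian group scheme realising a cube** (Cohn–Umans 2013,
Thm. 17 with §4.2, abelian case): a uniform STPP family `(A k, B k, C k)_{k ∈ κ}` in a finite
abelian group `G` with `|A k| = |B k| = |C k| = L` yields a COMMUTATIVE association scheme on the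
point set `κ → G` — the symmetric power `Sym^κ 𝒞_G`, whose classes are the multisets of
coordinate differences, labelled by `Fin #Sym^{|κ|} G` — realising `⟨L^{|κ|}, L^{|κ|}, L^{|κ|}⟩`
in the sense of CU13 Def. 12 (`Literature.Combinatorics.AssociationSchemes.Realizes`), through
`α(a, b') = {a k - b' k}ₖ`, `β(b, c') = {b k - c' k}ₖ`, `γ(c, a') = {c k - a' k}ₖ` on the boxes
`∏ A k, ∏ B k, ∏ C k` (numbered by `Fin (L^{|κ|})`). [cite: CohnUmans2013, Thm. 17] -/
theorem exists_symPower_scheme {G : Type} [AddCommGroup G] [Fintype G] [DecidableEq G]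
    {κ : Type} [Fintype κ] [DecidableEq κ] {A B C : κ → Finset G}
    (hS : Literature.Combinatorics.Additive.AddSimultaneousTPP A B C) {L : ℕ}
    (hA : ∀ k, (A k).card = L) (hB : ∀ k, (B k).card = L) (hC : ∀ k, (C k).card = L) :
    ∃ S : AssociationScheme (κ → G) (Fin (Fintype.card (Sym G (Fintype.card κ)))),
      S.IsCommutative ∧
        S.Realizes (L ^ Fintype.card κ) (L ^ Fintype.card κ) (L ^ Fintype.card κ) := by
  classical
  set K := Fintype.card κ with hK
  have hcard : ∀ f : κ → G, Multiset.card ((univ : Finset κ).val.map f) = K := by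
    intro f
    rw [Multiset.card_map]
    rfl
  set e := Fintype.equivFin (Sym G K) with he
  set cls : (κ → G) → (κ → G) → Fin (Fintype.card (Sym G K)) :=
    fun x y => e ⟨univ.val.map (y - x), hcard _⟩ with hcls_def
  have hcls : ∀ x y x' y', cls x y = cls x' y' ↔
      (univ : Finset κ).val.map (y - x) = univ.val.map (y' - x') := by
    intro x y x' y'
    rw [hcls_def, e.apply_eq_iff_eq]
    exact ⟨fun h => congrArg (fun s : Sym G K => (s : Multiset G)) h, fun h => Sym.ext h⟩
  have hcls' : ∀ (x y : κ → G) (s : Fin (Fintype.card (Sym G K))), cls x y = s ↔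
      (univ : Finset κ).val.map (y - x) = ((e.symm s : Sym G K) : Multiset G) := by
    intro x y s
    rw [hcls_def, Equiv.apply_eq_iff_eq_symm_apply, ← Sym.coe_inj]
    rfl
  refine ⟨⟨cls, fun x y z => ?_, ?_, ?_⟩, ?_, ?_⟩
  · -- one diagonal class
    rw [hcls]
    exact map_univ_sub_eq_map_univ_sub_self_iff x y z
  · -- transposition = negation of the difference multiset
    refine ⟨fun s => e ⟨((e.symm s : Sym G K) : Multiset G).map Neg.neg,
      by rw [Multiset.card_map, Sym.card_coe]⟩, fun x y => ?_⟩
    rw [hcls_def, e.apply_eq_iff_eq, e.symm_apply_apply]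
    apply Sym.ext
    exact map_univ_sub_swap x y
  · -- coherence
    refine ⟨fun a b c => if h : ∃ q : (κ → G) × (κ → G), cls q.1 q.2 = c then
        (univ.filter fun z => cls h.choose.1 z = a ∧ cls z h.choose.2 = b).card else 0,
      fun a b x y => ?_⟩
    have hex : ∃ q : (κ → G) × (κ → G), cls q.1 q.2 = cls x y := ⟨(x, y), rfl⟩
    dsimp only
    rw [dif_pos hex]
    have hq := hex.choose_spec
    generalize hex.choose = q at hq ⊢
    rw [hcls] at hq
    simp only [hcls']
    exact card_filter_eq_of_map_univ_sub_eq _ _ hq.symm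
  · -- commutativity
    intro a b x y
    show (univ.filter fun z => cls x z = a ∧ cls z y = b).card =
      (univ.filter fun z => cls x z = b ∧ cls z y = a).card
    simp only [hcls']
    exact card_filter_map_univ_sub_comm _ _ x y
  · -- realisation of the cube on the boxes `∏ A k`, `∏ B k`, `∏ C k`
    have hn : ∀ D : κ → Finset G, (∀ k, (D k).card = L) →
        Fintype.card ↥(Fintype.piFinset D) = L ^ K := by
      intro D hD
      rw [Fintype.card_coe, Fintype.card_piFinset]
      simp only [hD, prod_const, card_univ, hK]
    set eA : Fin (L ^ K) ≃ ↥(Fintype.piFinset A) := (Fintype.equivFinOfCardEq (hn A hA)).symm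
    set eB : Fin (L ^ K) ≃ ↥(Fintype.piFinset B) := (Fintype.equivFinOfCardEq (hn B hB)).symm
    set eC : Fin (L ^ K) ≃ ↥(Fintype.piFinset C) := (Fintype.equivFinOfCardEq (hn C hC)).symm
    have memA : ∀ i k, (eA i : κ → G) k ∈ A k := fun i => Fintype.mem_piFinset.1 (eA i).2
    have memB : ∀ i k, (eB i : κ → G) k ∈ B k := fun i => Fintype.mem_piFinset.1 (eB i).2
    have memC : ∀ i k, (eC i : κ → G) k ∈ C k := fun i => Fintype.mem_piFinset.1 (eC i).2
    set α : Fin (L ^ K) × Fin (L ^ K) → Fin (Fintype.card (Sym G K)) :=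
      fun p => e ⟨univ.val.map ((eA p.1 : κ → G) - (eB p.2 : κ → G)), hcard _⟩ with hα
    set β : Fin (L ^ K) × Fin (L ^ K) → Fin (Fintype.card (Sym G K)) :=
      fun p => e ⟨univ.val.map ((eB p.1 : κ → G) - (eC p.2 : κ → G)), hcard _⟩ with hβ
    set γ : Fin (L ^ K) × Fin (L ^ K) → Fin (Fintype.card (Sym G K)) :=
      fun p => e ⟨univ.val.map ((eC p.1 : κ → G) - (eA p.2 : κ → G)), hcard _⟩ with hγ
    have H : ∀ a a' b b' c c' : Fin (L ^ K), ((∃ x y z : κ → G, cls x y = α (a, b') ∧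
        cls y z = β (b, c') ∧ cls z x = γ (c, a')) ↔ (a = a' ∧ b = b' ∧ c = c')) := by
      intro a a' b b' c c'
      have h1 : ∀ x y : κ → G, cls x y = α (a, b') ↔ (univ : Finset κ).val.map (y - x) =
          univ.val.map ((eA a : κ → G) - (eB b' : κ → G)) := by
        intro x y
        rw [hcls_def, hα, e.apply_eq_iff_eq]
        exact ⟨fun h => congrArg (fun s : Sym G K => (s : Multiset G)) h, fun h => Sym.ext h⟩
      have h2 : ∀ y z : κ → G, cls y z = β (b, c') ↔ (univ : Finset κ).val.map (z - y) =
          univ.val.map ((eB b : κ → G) - (eC c' : κ → G)) := by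
        intro y z
        rw [hcls_def, hβ, e.apply_eq_iff_eq]
        exact ⟨fun h => congrArg (fun s : Sym G K => (s : Multiset G)) h, fun h => Sym.ext h⟩
      have h3 : ∀ z x : κ → G, cls z x = γ (c, a') ↔ (univ : Finset κ).val.map (x - z) =
          univ.val.map ((eC c : κ → G) - (eA a' : κ → G)) := by
        intro z x
        rw [hcls_def, hγ, e.apply_eq_iff_eq]
        exact ⟨fun h => congrArg (fun s : Sym G K => (s : Multiset G)) h, fun h => Sym.ext h⟩
      simp only [h1, h2, h3]
      rw [map_univ_sub_triangle_iff hS (memA a) (memA a') (memB b) (memB b') (memC c) (memC c'),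
        Subtype.val_inj, Subtype.val_inj, Subtype.val_inj, eA.apply_eq_iff_eq,
        eB.apply_eq_iff_eq, eC.apply_eq_iff_eq]
    obtain ⟨iα, iβ, iγ⟩ := injective_of_triangle_iff cls α β γ H
    exact ⟨α, β, γ, iα, iβ, iγ, H⟩

end SymPower

end Summit.MatrixMultiplication.MatrixMultiplication.Theorems
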